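import Summits.Ventures.PercRepro2.CaseOneRootsAndBIQCertA

/-!
# The Bernstein certificate of the `(i-Q)` form of the roots-and-`b` class — the coefficient
inequalities (blind cell PercRepro2, p1 g28; part B: the coefficients with r₁-index ≥ 2)

`IQAtoms m`: the facts every instance satisfies — the masses are nonnegative, the containment
differences `Q − b1 − b2 = [b ∉ U]`, `oU − o2 = [o ∈ C₁]`, `b1oU − b1o2 = [b ∈ C₁, o ∈ C₁]`,
`b2oU − b2o2 = [b ∈ C₂, o ∈ C₁]`, `oU − o2 − (b1oU − b1o2) − (b2oU − b2o2) = [o ∈ C₁, b ∉ U]` are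
nonnegative, and BHK 1.3 / 1.4 under `Q` for the pairs `(b, o)`: `b2·o2 ≤ Q·b2o2`,
`Q·b1o2 ≤ o2·b1`, `b1·(oU − o2) ≤ Q·(b1oU − b1o2)`, `Q·(b2oU − b2o2) ≤ (oU − o2)·b2`. Each theorem
`cXYZ_mul_nonneg` proves `0 ≤ Q · c_{XYZ}` as an explicit nonnegative combination of products of atoms
(the exact LP certificates of the owner's record, degree 4); `cXYZ_nonneg` divides by `Q > 0`.
Own code; standard axioms.
-/

namespace Summit.Ventures.PercRepro2

namespace CaseOne

namespace RootsAndBIQ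

variable {R : Type*} [Field R] [LinearOrder R] [IsStrictOrderedRing R]

/-- `0 ≤ Q · c_{200}`. -/
theorem c200_mul_nonneg {m : IQMasses R} (h : IQAtoms m) : 0 ≤ m.Q * c200 m := by
  unfold c200
  linarith [(mul_nonneg (mul_nonneg h.bhk14a h.Q_nonneg) h.Q_nonneg)]

/-- `0 ≤ c_{200}` when `Q > 0`. -/
theorem c200_nonneg {m : IQMasses R} (h : IQAtoms m) (hQ : 0 < m.Q) : 0 ≤ c200 m :=
  nonneg_of_mul_nonneg_right (by linarith [c200_mul_nonneg h] : 0 ≤ m.Q * c200 m) hQ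

/-- `0 ≤ Q · c_{201}`. -/
theorem c201_mul_nonneg {m : IQMasses R} (h : IQAtoms m) : 0 ≤ m.Q * c201 m := by
  unfold c201
  linarith [(mul_nonneg (mul_nonneg (mul_nonneg h.Q_nonneg h.Q_nonneg) h.o1_nonneg) h.bF_nonneg), (mul_nonneg (mul_nonneg (mul_nonneg h.Q_nonneg h.b1_nonneg) h.b2_nonneg) h.o1_nonneg), (mul_nonneg (mul_nonneg (mul_nonneg h.Q_nonneg h.b1_nonneg) h.o1_nonneg) h.bF_nonneg), (mul_nonneg (mul_nonneg h.bhk14a h.Q_nonneg) h.Q_nonneg), (mul_nonneg (mul_nonneg h.bhk14a h.Q_nonneg) h.b1_nonneg), (mul_nonneg (mul_nonneg h.bhk13a h.Q_nonneg) h.b2_nonneg), (mul_nonneg (mul_nonneg h.bhk14a h.Q_nonneg) h.bF_nonneg), (mul_nonneg (mul_nonneg h.bhk13a h.Q_nonneg) h.bF_nonneg)]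

/-- `0 ≤ c_{201}` when `Q > 0`. -/
theorem c201_nonneg {m : IQMasses R} (h : IQAtoms m) (hQ : 0 < m.Q) : 0 ≤ c201 m :=
  nonneg_of_mul_nonneg_right (by linarith [c201_mul_nonneg h] : 0 ≤ m.Q * c201 m) hQ

/-- `0 ≤ Q · c_{202}`. -/
theorem c202_mul_nonneg {m : IQMasses R} (h : IQAtoms m) : 0 ≤ m.Q * c202 m := by
  unfold c202
  linarith [(mul_nonneg (mul_nonneg (mul_nonneg h.Q_nonneg h.Q_nonneg) h.b1_nonneg) h.o1F_nonneg), (mul_nonneg (mul_nonneg (mul_nonneg h.Q_nonneg h.Q_nonneg) h.X1_nonneg) h.bF_nonneg), (mul_nonneg (mul_nonneg (mul_nonneg h.Q_nonneg h.Q_nonneg) h.o1_nonneg) h.bF_nonneg), (mul_nonneg (mul_nonneg (mul_nonneg h.Q_nonneg h.Q_nonneg) h.bF_nonneg) h.b1o1_nonneg), (mul_nonneg (mul_nonneg (mul_nonneg h.Q_nonneg h.Q_nonneg) h.bF_nonneg) h.o1F_nonneg), (mul_nonneg (mul_nonneg (mul_nonneg h.Q_nonneg h.b1_nonneg) h.b1_nonneg)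 h.b2o1_nonneg), (mul_nonneg (mul_nonneg (mul_nonneg h.Q_nonneg h.b1_nonneg) h.b2_nonneg) h.X1_nonneg), (mul_nonneg (mul_nonneg (mul_nonneg h.Q_nonneg h.b1_nonneg) h.b2_nonneg) h.o1_nonneg), (mul_nonneg (mul_nonneg (mul_nonneg h.Q_nonneg h.b1_nonneg) h.b2_nonneg) h.b1o1_nonneg), (mul_nonneg (mul_nonneg (mul_nonneg h.Q_nonneg h.b1_nonneg) h.b2_nonneg) h.o1F_nonneg), (mul_nonneg (mul_nonneg (mul_nonneg h.Q_nonneg h.b1_nonneg) h.X1_nonneg) h.bF_nonneg), (mul_nonneg (mul_nonneg h.bhk14a h.Q_nonneg) h.b1_nonneg), (mul_nonneg (mul_nonneg h.bhk13b h.Q_nonneg) h.b1_nonneg), (mul_nonneg (mul_nonneg h.bhk13a h.Q_nonneg) h.b2_nonneg), (mul_nonneg (mul_nonneg h.bhk14a h.Q_nonneg) h.bF_nonneg), (mul_nonneg (mul_nonneg h.bhk13a h.Q_nonneg) h.bF_nonneg), (mul_nonneg (mul_nonneg h.bhk14a h.b1_nonneg) h.b2_nonneg), (mul_nonneg (mul_nonneg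 h.bhk13a h.b2_nonneg) h.b2_nonneg), (mul_nonneg (mul_nonneg h.bhk13a h.b2_nonneg) h.bF_nonneg), (mul_nonneg (mul_nonneg h.bhk13a h.bF_nonneg) h.bF_nonneg)]

/-- `0 ≤ c_{202}` when `Q > 0`. -/
theorem c202_nonneg {m : IQMasses R} (h : IQAtoms m) (hQ : 0 < m.Q) : 0 ≤ c202 m :=
  nonneg_of_mul_nonneg_right (by linarith [c202_mul_nonneg h] : 0 ≤ m.Q * c202 m) hQ

/-- `0 ≤ Q · c_{203}`. -/
theorem c203_mul_nonneg {m : IQMasses R} (h : IQAtoms m) : 0 ≤ m.Q * c203 m := by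
  unfold c203
  linarith [(mul_nonneg (mul_nonneg (mul_nonneg h.Q_nonneg h.Q_nonneg) h.X1_nonneg) h.bF_nonneg), (mul_nonneg (mul_nonneg (mul_nonneg h.Q_nonneg h.Q_nonneg) h.bF_nonneg) h.b1o1_nonneg), (mul_nonneg (mul_nonneg (mul_nonneg h.Q_nonneg h.Q_nonneg) h.bF_nonneg) h.o1F_nonneg), (mul_nonneg (mul_nonneg (mul_nonneg h.Q_nonneg h.b1_nonneg) h.b2_nonneg) h.X1_nonneg), (mul_nonneg (mul_nonneg (mul_nonneg h.Q_nonneg h.b1_nonneg) h.b2_nonneg) h.b1o1_nonneg), (mul_nonneg (mul_nonneg (mul_nonneg h.Q_nonneg h.b1_nonneg) h.b2_nonneg) h.o1F_nonneg)]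

/-- `0 ≤ c_{203}` when `Q > 0`. -/
theorem c203_nonneg {m : IQMasses R} (h : IQAtoms m) (hQ : 0 < m.Q) : 0 ≤ c203 m :=
  nonneg_of_mul_nonneg_right (by linarith [c203_mul_nonneg h] : 0 ≤ m.Q * c203 m) hQ

/-- `0 ≤ Q · c_{210}`. -/
theorem c210_mul_nonneg {m : IQMasses R} (h : IQAtoms m) : 0 ≤ m.Q * c210 m := by
  unfold c210
  linarith [(mul_nonneg (mul_nonneg h.bhk14a h.Q_nonneg) h.Q_nonneg)]

/-- `0 ≤ c_{210}` when `Q > 0`. -/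
theorem c210_nonneg {m : IQMasses R} (h : IQAtoms m) (hQ : 0 < m.Q) : 0 ≤ c210 m :=
  nonneg_of_mul_nonneg_right (by linarith [c210_mul_nonneg h] : 0 ≤ m.Q * c210 m) hQ

/-- `0 ≤ Q · c_{211}`. -/
theorem c211_mul_nonneg {m : IQMasses R} (h : IQAtoms m) : 0 ≤ m.Q * c211 m := by
  unfold c211
  linarith [(mul_nonneg (mul_nonneg (mul_nonneg h.Q_nonneg h.Q_nonneg) h.o1_nonneg) h.bF_nonneg), (mul_nonneg (mul_nonneg (mul_nonneg h.Q_nonneg h.b1_nonneg) h.b2_nonneg) h.o1_nonneg), (mul_nonneg (mul_nonneg (mul_nonneg h.Q_nonneg h.b1_nonneg) h.o1_nonneg) h.bF_nonneg), (mul_nonneg (mul_nonneg h.bhk14a h.Q_nonneg) h.Q_nonneg), (mul_nonneg (mul_nonneg h.bhk13a h.Q_nonneg) h.b2_nonneg), (mul_nonneg (mul_nonneg h.bhk14a h.Q_nonneg) h.bF_nonneg), (mul_nonneg (mul_nonneg h.bhk13a h.Q_nonneg) h.bF_nonneg)]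

/-- `0 ≤ c_{211}` when `Q > 0`. -/
theorem c211_nonneg {m : IQMasses R} (h : IQAtoms m) (hQ : 0 < m.Q) : 0 ≤ c211 m :=
  nonneg_of_mul_nonneg_right (by linarith [c211_mul_nonneg h] : 0 ≤ m.Q * c211 m) hQ

/-- `0 ≤ Q · c_{212}`. -/
theorem c212_mul_nonneg {m : IQMasses R} (h : IQAtoms m) : 0 ≤ m.Q * c212 m := by
  unfold c212
  linarith [(mul_nonneg (mul_nonneg (mul_nonneg h.Q_nonneg h.Q_nonneg) h.b1_nonneg) h.o1F_nonneg), (mul_nonneg (mul_nonneg (mul_nonneg h.Q_nonneg h.Q_nonneg) h.X1_nonneg) h.bF_nonneg), (mul_nonneg (mul_nonneg (mul_nonneg h.Q_nonneg h.Q_nonneg) h.o1_nonneg) h.bF_nonneg), (mul_nonneg (mul_nonneg (mul_nonneg h.Q_nonneg h.Q_nonneg) h.bF_nonneg) h.b1o1_nonneg), (mul_nonneg (mul_nonneg (mul_nonneg h.Q_nonneg h.Q_nonneg) h.bF_nonneg) h.o1F_nonneg), (mul_nonneg (mul_nonneg (mul_nonneg h.Q_nonneg h.b1_nonneg) h.b1_nonneg)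 h.b2o1_nonneg), (mul_nonneg (mul_nonneg (mul_nonneg h.Q_nonneg h.b1_nonneg) h.b2_nonneg) h.X1_nonneg), (mul_nonneg (mul_nonneg (mul_nonneg h.Q_nonneg h.b1_nonneg) h.b2_nonneg) h.o1_nonneg), (mul_nonneg (mul_nonneg (mul_nonneg h.Q_nonneg h.b1_nonneg) h.b2_nonneg) h.b1o1_nonneg), (mul_nonneg (mul_nonneg (mul_nonneg h.Q_nonneg h.b1_nonneg) h.b2_nonneg) h.o1F_nonneg), (mul_nonneg (mul_nonneg (mul_nonneg h.Q_nonneg h.b1_nonneg) h.X1_nonneg) h.bF_nonneg), (mul_nonneg (mul_nonneg h.bhk13b h.Q_nonneg) h.b1_nonneg), (mul_nonneg (mul_nonneg h.bhk14a h.Q_nonneg) h.bF_nonneg), (mul_nonneg (mul_nonneg h.bhk14a h.b1_nonneg) h.b2_nonneg), (mul_nonneg (mul_nonneg h.bhk13a h.b2_nonneg) h.b2_nonneg), (mul_nonneg (mul_nonneg h.bhk13a h.b2_nonneg) h.bF_nonneg), (mul_nonneg (mul_nonneg h.bhk13a h.bF_nonneg) h.bF_nonneg)]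

/-- `0 ≤ c_{212}` when `Q > 0`. -/
theorem c212_nonneg {m : IQMasses R} (h : IQAtoms m) (hQ : 0 < m.Q) : 0 ≤ c212 m :=
  nonneg_of_mul_nonneg_right (by linarith [c212_mul_nonneg h] : 0 ≤ m.Q * c212 m) hQ

/-- `0 ≤ Q · c_{213}`. -/
theorem c213_mul_nonneg {m : IQMasses R} (h : IQAtoms m) : 0 ≤ m.Q * c213 m := by
  unfold c213
  linarith [(mul_nonneg (mul_nonneg (mul_nonneg h.Q_nonneg h.Q_nonneg) h.X1_nonneg) h.bF_nonneg), (mul_nonneg (mul_nonneg (mul_nonneg h.Q_nonneg h.Q_nonneg) h.bF_nonneg) h.b1o1_nonneg), (mul_nonneg (mul_nonneg (mul_nonneg h.Q_nonneg h.Q_nonneg) h.bF_nonneg) h.o1F_nonneg), (mul_nonneg (mul_nonneg (mul_nonneg h.Q_nonneg h.b1_nonneg) h.b2_nonneg) h.X1_nonneg), (mul_nonneg (mul_nonneg (mul_nonneg h.Q_nonneg h.b1_nonneg) h.b2_nonneg) h.b1o1_nonneg), (mul_nonneg (mul_nonneg (mul_nonneg h.Q_nonneg h.b1_nonneg) h.b2_nonneg)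 h.o1F_nonneg)]

/-- `0 ≤ c_{213}` when `Q > 0`. -/
theorem c213_nonneg {m : IQMasses R} (h : IQAtoms m) (hQ : 0 < m.Q) : 0 ≤ c213 m :=
  nonneg_of_mul_nonneg_right (by linarith [c213_mul_nonneg h] : 0 ≤ m.Q * c213 m) hQ

/-- `0 ≤ Q · c_{300}`. -/
theorem c300_mul_nonneg {m : IQMasses R} (h : IQAtoms m) : 0 ≤ m.Q * c300 m := by
  unfold c300
  linarith [(mul_nonneg (mul_nonneg h.bhk14a h.Q_nonneg) h.Q_nonneg)]

/-- `0 ≤ c_{300}` when `Q > 0`. -/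
theorem c300_nonneg {m : IQMasses R} (h : IQAtoms m) (hQ : 0 < m.Q) : 0 ≤ c300 m :=
  nonneg_of_mul_nonneg_right (by linarith [c300_mul_nonneg h] : 0 ≤ m.Q * c300 m) hQ

/-- `0 ≤ Q · c_{301}`. -/
theorem c301_mul_nonneg {m : IQMasses R} (h : IQAtoms m) : 0 ≤ m.Q * c301 m := by
  unfold c301
  linarith [(mul_nonneg (mul_nonneg h.bhk14a h.Q_nonneg) h.b1_nonneg), (mul_nonneg (mul_nonneg h.bhk13a h.Q_nonneg) h.b2_nonneg), (mul_nonneg (mul_nonneg h.bhk14a h.Q_nonneg) h.bF_nonneg), (mul_nonneg (mul_nonneg h.bhk13a h.Q_nonneg) h.bF_nonneg)]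

/-- `0 ≤ c_{301}` when `Q > 0`. -/
theorem c301_nonneg {m : IQMasses R} (h : IQAtoms m) (hQ : 0 < m.Q) : 0 ≤ c301 m :=
  nonneg_of_mul_nonneg_right (by linarith [c301_mul_nonneg h] : 0 ≤ m.Q * c301 m) hQ

/-- `0 ≤ Q · c_{302}`. -/
theorem c302_mul_nonneg {m : IQMasses R} (h : IQAtoms m) : 0 ≤ m.Q * c302 m := by
  unfold c302
  linarith [(mul_nonneg (mul_nonneg h.bhk13a h.Q_nonneg) h.bF_nonneg), (mul_nonneg (mul_nonneg h.bhk14a h.b1_nonneg) h.b1_nonneg), (mul_nonneg (mul_nonneg h.bhk13a h.b1_nonneg) h.b2_nonneg), (mul_nonneg (mul_nonneg h.bhk14a h.b1_nonneg) h.bF_nonneg), (mul_nonneg (mul_nonneg h.bhk14a h.bF_nonneg) h.bF_nonneg)]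

/-- `0 ≤ c_{302}` when `Q > 0`. -/
theorem c302_nonneg {m : IQMasses R} (h : IQAtoms m) (hQ : 0 < m.Q) : 0 ≤ c302 m :=
  nonneg_of_mul_nonneg_right (by linarith [c302_mul_nonneg h] : 0 ≤ m.Q * c302 m) hQ

end RootsAndBIQ

end CaseOne

end Summit.Ventures.PercRepro2
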